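import Mathlib
import HarnessLib
import Literature.Analysis.FluidPDE.AxisymHouLiVariables
import Summits.NavierStokesRegularity.NavierStokesRegularity.Theorems.TypeIQuarterGateScarEnvelopeTypeIForcedTsaiMoments
import Summits.NavierStokesRegularity.NavierStokesRegularity.Theorems.TypeIQuarterGateScarEnvelopeTypeIForcedTsaiFieldCalculus
import Summits.NavierStokesRegularity.NavierStokesRegularity.Theorems.TypeIQuarterGateScarEnvelopeTypeIForcedTsaiFieldSmooth

/-!
# Route `EfficiencyFloor`, support `SharpLuDoeringBudget` (stmt-NavierStokesRegularity-25481) — toolkit: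
# Gaussian × polynomial vector fields are admissible (`C^∞`, `D⁰, D¹, D² ∈ L²`), with explicit `∂_j`, `∂_k∂_j`, `curl`, `div`

For a rational rate `b` and three sparse polynomials `V : Fin 3 → QPoly` (the symbolic `ℚ[y₀,y₁,y₂]` calculus of the landed
`…TypeIQuarterGateScarEnvelopeTypeIForcedTsai{Cert,Semantics,FieldCalculus,FieldSmooth,Moments}` modules, reused BY NAME), the field
`F(y) = e^{−b|y|²}·V(y)` on `ℝ³` — always introduced through an unfolding hypothesis `hF : F = fun y => gauss b y • evalVec V y`,
no definitions — satisfies: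

* `fderiv_apply_single` / `fderiv_single` — `∂_j F_i = e^{−b|y|²}(Dg_{b,j} V_i)(y)`, i.e. `∂_j F` is again such a field with
  symbols `Dg b j ∘ V` (so the class is closed under coordinate derivatives);
* `fderiv_apply_eq_sum` — `DF(y)[v] = Σ_j v_j ∂_jF(y)`; `curl_eq`, `divergence_eq` — curl and divergence in symbols;
* `fderiv_fderiv_single` — `D²F(y)[e_k][e_j] = e^{−b|y|²}(Dg_k Dg_j V)(y)`;
* `opNorm_le_sum_norm_apply_single` — `‖T‖ ≤ Σ_j ‖T e_j‖` for a continuous linear map on `ℝ³`;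
* `norm_sq_eq`, `integrable_norm_sq` — `‖F‖² = 1·⟪V,V⟫·e^{−2b|y|²} ∈ L¹` (the landed `moment_pairVec`, `b > 0`);
* `lintegral_iteratedFDeriv_zero_lt_top`, `…_one_…`, `…_two_…` — `∫⁻ ‖DⁿF‖ₑ² < ⊤` for `n = 0, 1, 2`;
* `admissible` — the admissible-class conjunction of `Theses.EfficiencyFloor.SharpLuDoeringBudget` for `F`, given `b > 0` and the
  value-level identity `Σ_i (Dg_{b,i} V_i)(y) = 0` (divergence-freeness).

Used by `…EfficiencyFloorSharpLuDoeringBudget` (the positive-stretching witness).  HONEST FRAMING: elementary real analysis of explicit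
Gaussian × polynomial fields; nothing here bears on Navier–Stokes regularity. [folklore]
-/

noncomputable section

set_option linter.dupNamespace false

namespace Summit.NavierStokesRegularity.NavierStokesRegularity.Theorems.EfficiencyFloorSharpLuDoering.GaussField

open MeasureTheory Set Real Finset
open scoped RealInnerProductSpace ContDiff ENNReal
open Literature.Analysis.FluidPDE
open Summit.NavierStokesRegularity.NavierStokesRegularity.Cruxes.ScarEnvelopeTypeI.ForcedTsai

variable {b : ℚ} {V : Fin 3 → QPoly} {F : E3 → E3}

/-! ## Components, smoothness, first derivatives -/

/-- Components: `F_i(y) = e^{−b|y|²} V_i(y)`. [folklore] -/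
theorem apply_eq (hF : F = fun y => gauss (b : ℝ) y • evalVec V y) (y : E3) (i : Fin 3) :
    F y i = gauss (b : ℝ) y * QPoly.eval (V i) y := by
  subst hF
  simp [evalVec, PiLp.smul_apply]

/-- `F` is smooth (Gaussian times polynomials). [folklore] -/
theorem contDiff (hF : F = fun y => gauss (b : ℝ) y • evalVec V y) {n : WithTop ℕ∞} : ContDiff ℝ n F := by
  subst hF
  exact (contDiff_gauss _).smul (contDiff_evalVec V)

/-- `F` is differentiable. [folklore] -/
theorem differentiableAt (hF : F = fun y => gauss (b : ℝ) y • evalVec V y) (y : E3) : DifferentiableAt ℝ F y :=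
  ((contDiff hF (n := 1)).differentiable one_ne_zero).differentiableAt

/-- `DF` is differentiable. [folklore] -/
theorem differentiableAt_fderiv (hF : F = fun y => gauss (b : ℝ) y • evalVec V y) (y : E3) :
    DifferentiableAt ℝ (fderiv ℝ F) y :=
  (((contDiff hF (n := 2)).fderiv_right (m := 1) (by norm_num)).differentiable one_ne_zero).differentiableAt

/-- **Partial derivatives in symbols**: `∂_j F_i (y) = e^{−b|y|²}·(Dg_{b,j} V_i)(y)`. [folklore] -/
theorem fderiv_apply_single (hF : F = fun y => gauss (b : ℝ) y • evalVec V y) (y : E3) (i j : Fin 3) :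
    fderiv ℝ F y (EuclideanSpace.single j 1) i = gauss (b : ℝ) y * QPoly.eval (Dg b j (V i)) y := by
  have hcomp : fderiv ℝ F y (EuclideanSpace.single j 1) i =
      fderiv ℝ (fun y => F y i) y (EuclideanSpace.single j 1) := by
    have h := ((EuclideanSpace.proj i : E3 →L[ℝ] ℝ).hasFDerivAt.comp y (differentiableAt hF y).hasFDerivAt)
    have h' : fderiv ℝ (fun y => F y i) y = (EuclideanSpace.proj i : E3 →L[ℝ] ℝ) ∘L fderiv ℝ F y := by
      have : (fun y => F y i) = (EuclideanSpace.proj i : E3 →L[ℝ] ℝ) ∘ F := by funext y; rfl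
      rw [this]; exact h.fderiv
    rw [h']; rfl
  rw [hcomp]
  have hfun : (fun y => F y i) = (gauss (b : ℝ)) * fun y => QPoly.eval (V i) y := by
    funext y; exact apply_eq hF y i
  rw [hfun, fderiv_mul (differentiableAt_gauss _ y) (QPoly.differentiableAt_eval _ y)]
  simp only [FunLike.coe_add, FunLike.coe_smul, Pi.add_apply, Pi.smul_apply, smul_eq_mul]
  rw [fderiv_gauss_single, QPoly.fderiv_eval_single, eval_Dg]
  ring

/-- **Closure under `∂_j`**: `∂_j F (y) = e^{−b|y|²}·(Dg_{b,j} V)(y)` as a vector — again a Gaussian × polynomial field. [folklore] -/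
theorem fderiv_single (hF : F = fun y => gauss (b : ℝ) y • evalVec V y) (y : E3) (j : Fin 3) :
    fderiv ℝ F y (EuclideanSpace.single j 1) = gauss (b : ℝ) y • evalVec (fun i => Dg b j (V i)) y := by
  ext i
  rw [fderiv_apply_single hF y i j, PiLp.smul_apply, smul_eq_mul]
  simp [evalVec]

/-- The partial-derivative field as a function: `(y ↦ DF(y) e_j) = (y ↦ e^{−b|y|²}·(Dg_{b,j} V)(y))`. [folklore] -/
theorem fderiv_single_eq_fun (hF : F = fun y => gauss (b : ℝ) y • evalVec V y) (j : Fin 3) :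
    (fun y => fderiv ℝ F y (EuclideanSpace.single j 1)) = fun y => gauss (b : ℝ) y • evalVec (fun i => Dg b j (V i)) y :=
  funext fun y => fderiv_single hF y j

/-- **Linearity**: `DF(y)[v] = Σ_j v_j ∂_jF(y)` (expand `v = Σ_j v_j e_j`, the coordinate identity of the landed
`SymBasis.eq_sum_single`, inlined to keep this module's imports light). [folklore] -/
theorem fderiv_apply_eq_sum (hF : F = fun y => gauss (b : ℝ) y • evalVec V y) (y v : E3) :
    fderiv ℝ F y v = ∑ j : Fin 3, v j • (gauss (b : ℝ) y • evalVec (fun i => Dg b j (V i)) y) := by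
  have hv : v = ∑ j : Fin 3, v j • EuclideanSpace.single j (1 : ℝ) := by
    simpa using ((EuclideanSpace.basisFun (Fin 3) ℝ).sum_repr v).symm
  conv_lhs => rw [hv]
  rw [map_sum]
  refine Finset.sum_congr rfl fun j _ => ?_
  rw [map_smul, fderiv_single hF y j]

/-- **Curl in symbols**: `curl F (y) = e^{−b|y|²}·(Dg_1V_2 − Dg_2V_1, Dg_2V_0 − Dg_0V_2, Dg_0V_1 − Dg_1V_0)(y)`. [folklore] -/
theorem curl_eq (hF : F = fun y => gauss (b : ℝ) y • evalVec V y) (y : E3) :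
    curl F y = gauss (b : ℝ) y • evalVec ![QPoly.sub (Dg b 1 (V 2)) (Dg b 2 (V 1)),
      QPoly.sub (Dg b 2 (V 0)) (Dg b 0 (V 2)), QPoly.sub (Dg b 0 (V 1)) (Dg b 1 (V 0))] y := by
  have hD : ∀ i j : Fin 3, fderiv ℝ F y (EuclideanSpace.single j 1) i =
      gauss (b : ℝ) y * QPoly.eval (Dg b j (V i)) y := fun i j => fderiv_apply_single hF y i j
  ext k
  rw [PiLp.smul_apply, smul_eq_mul]
  simp only [curl, evalVec, PiLp.toLp_apply]
  fin_cases k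
  · simp only [Fin.zero_eta, Fin.isValue, Matrix.cons_val_zero, hD, QPoly.eval_sub]
    ring
  · simp only [Fin.mk_one, Fin.isValue, Matrix.cons_val_one, Matrix.cons_val_zero, hD, QPoly.eval_sub]
    ring
  · simp only [Fin.reduceFinMk, Fin.isValue, Matrix.cons_val, hD, QPoly.eval_sub]
    ring

/-- **Divergence in symbols**: `div F (y) = e^{−b|y|²}·Σ_i (Dg_{b,i} V_i)(y)`. [folklore] -/
theorem divergence_eq (hF : F = fun y => gauss (b : ℝ) y • evalVec V y) (y : E3) :
    VectorCalculus.divergence F y = gauss (b : ℝ) y *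
      (QPoly.eval (Dg b 0 (V 0)) y + QPoly.eval (Dg b 1 (V 1)) y + QPoly.eval (Dg b 2 (V 2)) y) := by
  rw [divergence_eq_sum_three, fderiv_apply_single hF y 0 0, fderiv_apply_single hF y 1 1, fderiv_apply_single hF y 2 2]
  ring

/-- `F` is divergence-free as soon as `Σ_i (Dg_{b,i} V_i)(y) ≡ 0`. [folklore] -/
theorem isDivFree (hF : F = fun y => gauss (b : ℝ) y • evalVec V y)
    (hdiv : ∀ y : E3, QPoly.eval (Dg b 0 (V 0)) y + QPoly.eval (Dg b 1 (V 1)) y + QPoly.eval (Dg b 2 (V 2)) y = 0) :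
    VectorCalculus.IsDivFree F := fun y => by
  rw [divergence_eq hF y, hdiv y, mul_zero]

/-! ## Second derivatives -/

/-- **Second partials in symbols**: `D²F(y)[e_k][e_j] = D(∂_jF)(y)[e_k] = e^{−b|y|²}·(Dg_k Dg_j V)(y)`. [folklore] -/
theorem fderiv_fderiv_single (hF : F = fun y => gauss (b : ℝ) y • evalVec V y) (y : E3) (k j : Fin 3) :
    fderiv ℝ (fderiv ℝ F) y (EuclideanSpace.single k 1) (EuclideanSpace.single j 1) =
      gauss (b : ℝ) y • evalVec (fun i => Dg b k (Dg b j (V i))) y := by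
  have h1 : fderiv ℝ (fderiv ℝ F) y (EuclideanSpace.single k 1) (EuclideanSpace.single j 1) =
      fderiv ℝ (fun y => fderiv ℝ F y (EuclideanSpace.single j 1)) y (EuclideanSpace.single k 1) := by
    rw [fderiv_clm_apply (differentiableAt_fderiv hF y) (differentiableAt_const _)]
    simp
  rw [h1, fderiv_single_eq_fun hF j, fderiv_single (F := fun y => gauss (b : ℝ) y • evalVec (fun i => Dg b j (V i)) y) rfl y k]

/-! ## Operator norms on `ℝ³` -/

/-- `‖T‖ ≤ Σ_j ‖T e_j‖` for a continuous linear map on `ℝ³` into any normed space (expand `v = Σ v_j e_j`, `|v_j| ≤ ‖v‖`;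
the landed `…PlanarEnergyAPrioriPressureGradient` has the functional case `X = ℝ`). [folklore] -/
theorem opNorm_le_sum_norm_apply_single {X : Type*} [NormedAddCommGroup X] [NormedSpace ℝ X] (T : E3 →L[ℝ] X) :
    ‖T‖ ≤ ∑ j : Fin 3, ‖T (EuclideanSpace.single j 1)‖ := by
  refine ContinuousLinearMap.opNorm_le_bound _ (Finset.sum_nonneg fun _ _ => norm_nonneg _) fun v => ?_
  have hv : v = ∑ j : Fin 3, v j • EuclideanSpace.single j (1 : ℝ) := by
    simpa using ((EuclideanSpace.basisFun (Fin 3) ℝ).sum_repr v).symm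
  calc ‖T v‖ = ‖∑ j : Fin 3, v j • T (EuclideanSpace.single j 1)‖ := by
        conv_lhs => rw [hv]
        simp [map_sum, map_smul]
    _ ≤ ∑ j : Fin 3, ‖v j • T (EuclideanSpace.single j 1)‖ := norm_sum_le _ _
    _ ≤ ∑ j : Fin 3, ‖v‖ * ‖T (EuclideanSpace.single j 1)‖ := by
        refine Finset.sum_le_sum fun j _ => ?_
        rw [norm_smul]
        exact mul_le_mul_of_nonneg_right (PiLp.norm_apply_le v j) (norm_nonneg _)
    _ = (∑ j : Fin 3, ‖T (EuclideanSpace.single j 1)‖) * ‖v‖ := by rw [← Finset.mul_sum]; ring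

/-- `‖T‖² ≤ 3 Σ_j ‖T e_j‖²` on `ℝ³` (Cauchy–Schwarz on the previous bound). [folklore] -/
theorem opNorm_sq_le (X : Type*) [NormedAddCommGroup X] [NormedSpace ℝ X] (T : E3 →L[ℝ] X) :
    ‖T‖ ^ 2 ≤ 3 * ∑ j : Fin 3, ‖T (EuclideanSpace.single j 1)‖ ^ 2 := by
  calc ‖T‖ ^ 2 ≤ (∑ j : Fin 3, ‖T (EuclideanSpace.single j 1)‖) ^ 2 :=
        pow_le_pow_left₀ (norm_nonneg _) (opNorm_le_sum_norm_apply_single T) 2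
    _ ≤ 3 * ∑ j : Fin 3, ‖T (EuclideanSpace.single j 1)‖ ^ 2 := by
        have h := sq_sum_le_card_mul_sum_sq (s := (Finset.univ : Finset (Fin 3)))
          (f := fun j : Fin 3 => ‖T (EuclideanSpace.single j 1)‖)
        simpa using h

/-! ## Square-integrability -/

/-- `‖F(y)‖² = 1·⟪V(y),V(y)⟫·e^{−2b|y|²}` (the integrand shape of `moment_pairVec`). [folklore] -/
theorem norm_sq_eq (hF : F = fun y => gauss (b : ℝ) y • evalVec V y) (y : E3) :
    ‖F y‖ ^ 2 = QPoly.eval [⟨0, 0, 0, 1⟩] y * ⟪evalVec V y, evalVec V y⟫ * gauss ((2 * b : ℚ) : ℝ) y := by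
  subst hF
  rw [norm_smul, mul_pow, Real.norm_of_nonneg (gauss_pos _ _).le, ← real_inner_self_eq_norm_sq, eval_one, sq,
    gauss_mul]
  push_cast
  ring_nf

/-- `‖F‖² ∈ L¹(ℝ³)` for `b > 0` (Gaussian moments). [folklore] -/
theorem integrable_norm_sq (hF : F = fun y => gauss (b : ℝ) y • evalVec V y) (hb : 0 < b) :
    Integrable (fun y => ‖F y‖ ^ 2) := by
  have h := (moment_pairVec [⟨0, 0, 0, 1⟩] V V (b := 2 * b) (by positivity)).1
  refine h.congr (Filter.Eventually.of_forall fun y => ?_)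
  exact (norm_sq_eq hF y).symm

/-- From a pointwise integrable majorant of `‖h‖²` to `∫⁻ ‖h‖ₑ² < ⊤`. [folklore] -/
theorem lintegral_enorm_sq_lt_top_of_le {X : Type*} [NormedAddCommGroup X] {h : E3 → X} {g : E3 → ℝ}
    (hg : Integrable g) (hle : ∀ y, ‖h y‖ ^ 2 ≤ g y) : ∫⁻ y, ‖h y‖ₑ ^ 2 < ⊤ := by
  have h1 : ∀ y, ‖h y‖ₑ ^ 2 = ENNReal.ofReal (‖h y‖ ^ 2) := fun y => by
    rw [← ofReal_norm, ENNReal.ofReal_pow (norm_nonneg _)]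
  calc ∫⁻ y, ‖h y‖ₑ ^ 2 = ∫⁻ y, ENNReal.ofReal (‖h y‖ ^ 2) := lintegral_congr fun y => h1 y
    _ ≤ ∫⁻ y, ENNReal.ofReal (g y) := lintegral_mono fun y => ENNReal.ofReal_le_ofReal (hle y)
    _ ≤ ∫⁻ y, ‖g y‖ₑ := lintegral_ofReal_le_lintegral_enorm g
    _ < ⊤ := hg.2

/-- **`D⁰F ∈ L²`**: `∫⁻ ‖iteratedFDeriv ℝ 0 F‖ₑ² < ⊤`. [folklore] -/
theorem lintegral_iteratedFDeriv_zero_lt_top (hF : F = fun y => gauss (b : ℝ) y • evalVec V y) (hb : 0 < b) :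
    ∫⁻ y, ‖iteratedFDeriv ℝ 0 F y‖ₑ ^ 2 < ⊤ :=
  lintegral_enorm_sq_lt_top_of_le (integrable_norm_sq hF hb) fun y => by rw [norm_iteratedFDeriv_zero]

/-- **`D¹F ∈ L²`**: `∫⁻ ‖iteratedFDeriv ℝ 1 F‖ₑ² < ⊤` (`‖DF‖² ≤ 3 Σ_j ‖∂_jF‖²`, each `∂_jF` a Gaussian × polynomial field). [folklore] -/
theorem lintegral_iteratedFDeriv_one_lt_top (hF : F = fun y => gauss (b : ℝ) y • evalVec V y) (hb : 0 < b) :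
    ∫⁻ y, ‖iteratedFDeriv ℝ 1 F y‖ₑ ^ 2 < ⊤ := by
  have hint : Integrable (fun y : E3 => (3 : ℝ) * ∑ j : Fin 3,
      ‖(fun y => gauss (b : ℝ) y • evalVec (fun i => Dg b j (V i)) y) y‖ ^ 2) :=
    (integrable_finsetSum _ fun j _ =>
      integrable_norm_sq (F := fun y => gauss (b : ℝ) y • evalVec (fun i => Dg b j (V i)) y) rfl hb).const_mul 3
  refine lintegral_enorm_sq_lt_top_of_le hint fun y => ?_
  rw [norm_iteratedFDeriv_one]
  refine (opNorm_sq_le E3 (fderiv ℝ F y)).trans (le_of_eq ?_)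
  congr 1
  refine Finset.sum_congr rfl fun j _ => ?_
  rw [fderiv_single hF y j]

/-- **`D²F ∈ L²`**: `∫⁻ ‖iteratedFDeriv ℝ 2 F‖ₑ² < ⊤` (`‖D²F‖² ≤ 9 Σ_{k,j} ‖∂_k∂_jF‖²`). [folklore] -/
theorem lintegral_iteratedFDeriv_two_lt_top (hF : F = fun y => gauss (b : ℝ) y • evalVec V y) (hb : 0 < b) :
    ∫⁻ y, ‖iteratedFDeriv ℝ 2 F y‖ₑ ^ 2 < ⊤ := by
  have hint : Integrable (fun y : E3 => (3 : ℝ) * ∑ k : Fin 3, ((3 : ℝ) * ∑ j : Fin 3,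
      ‖(fun y => gauss (b : ℝ) y • evalVec (fun i => Dg b k (Dg b j (V i))) y) y‖ ^ 2)) :=
    (integrable_finsetSum _ fun k _ => (integrable_finsetSum _ fun j _ =>
      integrable_norm_sq (F := fun y => gauss (b : ℝ) y • evalVec (fun i => Dg b k (Dg b j (V i))) y) rfl hb).const_mul
        3).const_mul 3
  refine lintegral_enorm_sq_lt_top_of_le hint fun y => ?_
  rw [← norm_iteratedFDeriv_fderiv, norm_iteratedFDeriv_one]
  refine (opNorm_sq_le (E3 →L[ℝ] E3) (fderiv ℝ (fderiv ℝ F) y)).trans ?_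
  refine mul_le_mul_of_nonneg_left (Finset.sum_le_sum fun k _ => ?_) (by norm_num)
  refine (opNorm_sq_le E3 (fderiv ℝ (fderiv ℝ F) y (EuclideanSpace.single k 1))).trans (le_of_eq ?_)
  congr 1
  refine Finset.sum_congr rfl fun j _ => ?_
  rw [fderiv_fderiv_single hF y k j]

/-! ## The admissible class -/

/-- **Gaussian × polynomial fields are admissible** for `Theses.EfficiencyFloor.SharpLuDoeringBudget`: smooth, divergence-free
(given the symbolic identity `Σ_i Dg_{b,i}V_i ≡ 0`), and `D⁰F, D¹F, D²F ∈ L²` (`b > 0`). [folklore] -/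
theorem admissible (hF : F = fun y => gauss (b : ℝ) y • evalVec V y) (hb : 0 < b)
    (hdiv : ∀ y : E3, QPoly.eval (Dg b 0 (V 0)) y + QPoly.eval (Dg b 1 (V 1)) y + QPoly.eval (Dg b 2 (V 2)) y = 0) :
    ContDiff ℝ (⊤ : ℕ∞) F ∧ VectorCalculus.IsDivFree F ∧ (∫⁻ y, ‖iteratedFDeriv ℝ 0 F y‖ₑ ^ 2 < ⊤) ∧
      (∫⁻ y, ‖iteratedFDeriv ℝ 1 F y‖ₑ ^ 2 < ⊤) ∧ (∫⁻ y, ‖iteratedFDeriv ℝ 2 F y‖ₑ ^ 2 < ⊤) :=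
  ⟨contDiff hF, isDivFree hF hdiv, lintegral_iteratedFDeriv_zero_lt_top hF hb, lintegral_iteratedFDeriv_one_lt_top hF hb,
    lintegral_iteratedFDeriv_two_lt_top hF hb⟩

end Summit.NavierStokesRegularity.NavierStokesRegularity.Theorems.EfficiencyFloorSharpLuDoering.GaussField

end
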